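import Summits.RiemannHypothesis.RiemannHypothesis.Theses.SmoothSectorHardy
import Summits.RiemannHypothesis.RiemannHypothesis.Theses.ScrewLemmaKCoprofile
import Summits.RiemannHypothesis.RiemannHypothesis.Theorems.SmoothSectorHardyParsevalFEOfIsometry
import Summits.RiemannHypothesis.RiemannHypothesis.Theorems.ScrewLemmaKCoprofileIsometryC1
import HarnessLib

/-!
# Route `SmoothSectorHardy`, item `ProfileParsevalFE` (K1b, stmt-RiemannHypothesis-22983)

`ProfileParsevalFE` (rev 1): for every admissible `g` with `(h−h₀)²/y²` integrable on `(0,1)`,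
`∫₀¹(h−h₀)²/y² + h₀² = (8π³)⁻¹∫_ℝ‖∫₀¹g′(u)u^{−1/2+it}du‖²‖ζ(3/2+it)‖²dt` (the global hypothesis
`ProfileMellinFormula`, item 22982, is carried by the item but not needed for the proof).
Proof: the tree's PROFILE ISOMETRY for all `C¹` data
(`…Theorems.ScrewLemmaKCoprofile.profile_isometry`, prover-l17's port of rh-idea-5's density
argument: `∫₀¹(h−h₀)²/y² + h₀² = (4π²)⁻¹∫₀¹Φ_g²`) is exactly route `ScrewLemmaKCoprofile`'s crux
`CoprofileIsometry`, and the tree glue `profileParsevalFE_of_coprofileIsometry` (K1 ⇒ K1b through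
the co-profile Parseval `coprofileParseval`, item 22439: `(4π²)⁻¹·(2π)⁻¹ = (8π³)⁻¹`) finishes.
RH-free; nothing here bears on the truth of RH.

Main result: `profileParsevalFE_proof : …Theses.SmoothSectorHardy.ProfileParsevalFE`.
-/

set_option linter.dupNamespace false

noncomputable section

namespace Summit.RiemannHypothesis.RiemannHypothesis.Theorems.SmoothSectorHardy

open MeasureTheory Set
open Summit.RiemannHypothesis.RiemannHypothesis.Theorems.ScrewLemmaKCoprofile (profile_isometry)

/-- **Item `ProfileParsevalFE` (K1b, stmt-RiemannHypothesis-22983)**, the route decl by name: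
K1 (the tree's `profile_isometry`, which needs only `g ∈ C¹[0,1]`, `g(1) = 0`, `∫₀¹ g = 0` from
admissibility) fed into the glue `profileParsevalFE_of_coprofileIsometry`. RH-free. [folklore] -/
theorem profileParsevalFE_proof :
    Summit.RiemannHypothesis.RiemannHypothesis.Theses.SmoothSectorHardy.ProfileParsevalFE := by
  apply profileParsevalFE_of_coprofileIsometry
  intro g hg hint
  exact profile_isometry hg.1 hg.2.1 hg.2.2.1 hint

end Summit.RiemannHypothesis.RiemannHypothesis.Theorems.SmoothSectorHardy

end
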